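import Summits.QuantumFields.GaugeBoot.BootstrapTranslationAveraging
import Mathlib.Analysis.Asymptotics.SpecificAsymptotics
import HarnessLib

/-!
# Banach limits of sequences of functionals; unit translations generate all translations (gauge-boot, L1/L4 supplement)

HONEST FRAMING (cell `pub-gaugeboot`, page 1 of every file): the venture produces certified bounds
on lattice expectations at stated coupling, gauge group, dimension and torus size; NOT a mass gap,
NOT a continuum limit, NOT a string tension; NOT Yang–Mills-summit-bearing (barriers
`FixedCouplingUltralocality`, `PerturbativeInvisibility`). Tools only; this file certifies no number.

## Content

* `cLim_eq_of_tendsto` — the Banach limit `CesaroLimit.cLim` of `InvariantMeanZd` extends the limit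
  (Cesàro means of a convergent sequence converge, `Filter.Tendsto.cesaro`);
* `seqBounded χ` / `seqLim χ` — for a sequence `χ_k` of linear functionals on a real vector space:
  the subspace where `(χ_k x)_k` is bounded, and a linear functional on the whole space which there
  is the Banach limit `cLim (k ↦ χ_k x)`; `seqLim_apply`, `seqLim_eq_of_forall_eq`, `seqLim_nonneg`,
  `le_seqLim`, ★ `seqLim_eq_of_tendsto_sub` (differences tending to `0` vanish in the limit);
* `comp_relabelCM_edgeShift_zero`; ★ `forall_invariant_of_single` — a functional invariant on a
  translation-stable set of observables of `ℤ^d` under the UNIT translations `τ_{e_j}` is invariant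
  under every translation (the good translations form a `ℤ`-submodule containing the basis
  `Pi.basisFun`).

Used by `BootstrapTranslationReductionBoxes.lean`. Folklore.
-/

noncomputable section

open MeasureTheory Filter Topology NormedSpace Finset
open Literature.MathematicalPhysics.QuantumFieldTheory (LatticeRep)
open Literature.MathematicalPhysics.QuantumLattice

namespace Summit.QuantumFields.GaugeBoot

open CesaroLimit

/-! ## Banach limits of sequences of functionals -/

section SeqLim

/-- The hyperfilter refines `atTop` on `ℕ`. -/
private theorem hyperfilter_le_atTop' : (↑(hyperfilter ℕ) : Filter ℕ) ≤ atTop :=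
  hyperfilter_le_cofinite.trans_eq Nat.cofinite_eq_atTop

/-- **A Banach limit extends the limit**: `cLim a = l` whenever `a → l`. [folklore] -/
theorem cLim_eq_of_tendsto {a : ℕ → ℝ} {l : ℝ} (h : Tendsto a atTop (𝓝 l)) : cLim a = l := by
  have hc : Tendsto (cesaroAvg a) atTop (𝓝 l) := by
    have h2 := h.cesaro.comp (tendsto_add_atTop_nat 1)
    refine h2.congr fun n => ?_
    simp only [Function.comp_apply, cesaroAvg, Nat.cast_add, Nat.cast_one]
    rw [div_eq_inv_mul]
  exact (hc.mono_left hyperfilter_le_atTop').limUnder_eq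

variable {A : Type*} [AddCommGroup A] [Module ℝ A] (χ : ℕ → A →ₗ[ℝ] ℝ)

/-- **The elements on which a sequence of functionals is bounded** (a linear subspace). -/
def seqBounded : Submodule ℝ A where
  carrier := {x | ∃ M : ℝ, ∀ k, |χ k x| ≤ M}
  zero_mem' := ⟨0, fun k => by simp⟩
  add_mem' := by
    rintro x y ⟨Mx, hx⟩ ⟨My, hy⟩
    exact ⟨Mx + My, fun k => by rw [map_add]; exact (abs_add_le _ _).trans (add_le_add (hx k) (hy k))⟩
  smul_mem' := by
    rintro c x ⟨M, hx⟩
    refine ⟨|c| * M, fun k => ?_⟩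
    rw [map_smul, smul_eq_mul, abs_mul]
    exact mul_le_mul_of_nonneg_left (hx k) (abs_nonneg c)

/-- The Banach limit of the sequence, on the bounded elements. -/
def seqLimOn : seqBounded χ →ₗ[ℝ] ℝ where
  toFun x := cLim fun k => χ k x
  map_add' x y := by
    obtain ⟨Mx, hx⟩ := x.2
    obtain ⟨My, hy⟩ := y.2
    have h : (fun k => χ k ((x : A) + y)) = (fun k => χ k x) + fun k => χ k y := by
      funext k; simp only [map_add, Pi.add_apply]
    simp only [Submodule.coe_add, h]
    exact cLim_add hx hy
  map_smul' c x := by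
    obtain ⟨M, hx⟩ := x.2
    have h : (fun k => χ k (c • (x : A))) = c • fun k => χ k x := by
      funext k; simp only [map_smul, Pi.smul_apply]
    simp only [Submodule.coe_smul, RingHom.id_apply, smul_eq_mul, h]
    exact cLim_smul hx c

/-- **The Banach limit of a sequence of functionals**: a linear functional on all of `A` which on the
bounded elements is `cLim (k ↦ χ_k x)`. [folklore] -/
def seqLim : A →ₗ[ℝ] ℝ := Classical.choose (LinearMap.exists_extend (seqLimOn χ))

/-- On bounded elements the limit functional is the Banach limit of the values. -/
theorem seqLim_apply {x : A} (hx : x ∈ seqBounded χ) : seqLim χ x = cLim fun k => χ k x := by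
  have h := LinearMap.congr_fun (Classical.choose_spec (LinearMap.exists_extend (seqLimOn χ))) ⟨x, hx⟩
  unfold seqLim
  simpa [seqLimOn] using h

/-- A constant value sequence has that limit. -/
theorem seqLim_eq_of_forall_eq {x : A} {c : ℝ} (h : ∀ k, χ k x = c) : seqLim χ x = c := by
  rw [seqLim_apply χ ⟨|c|, fun k => by rw [h k]⟩, show (fun k => χ k x) = fun _ => c from funext h]
  exact cLim_const c

/-- Positivity passes to the limit. -/
theorem seqLim_nonneg {x : A} (hx : x ∈ seqBounded χ) (h : ∀ k, 0 ≤ χ k x) : 0 ≤ seqLim χ x := by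
  obtain ⟨M, hM⟩ := id hx
  rw [seqLim_apply χ hx]
  exact le_cLim_of_le hM h

/-- A uniform lower bound passes to the limit. -/
theorem le_seqLim {x : A} (hx : x ∈ seqBounded χ) {t : ℝ} (h : ∀ k, t ≤ χ k x) : t ≤ seqLim χ x := by
  obtain ⟨M, hM⟩ := id hx
  rw [seqLim_apply χ hx]
  exact le_cLim_of_le hM h

/-- **Differences tending to zero vanish in the limit**: if `χ_k x - χ_k y → 0` (both bounded) then
`seqLim χ x = seqLim χ y`. -/
theorem seqLim_eq_of_tendsto_sub {x y : A} (hx : x ∈ seqBounded χ) (hy : y ∈ seqBounded χ)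
    (h : Tendsto (fun k => χ k x - χ k y) atTop (𝓝 0)) : seqLim χ x = seqLim χ y := by
  obtain ⟨Mx, hMx⟩ := id hx
  obtain ⟨My, hMy⟩ := id hy
  have hsub : cLim ((fun k => χ k x) - fun k => χ k y) = 0 :=
    cLim_eq_of_tendsto (a := (fun k => χ k x) - fun k => χ k y) h
  rw [seqLim_apply χ hx, seqLim_apply χ hy, ← sub_eq_zero, ← hsub]
  have hneg : ∀ k, |(-fun k => χ k y) k| ≤ My := fun k => by rw [Pi.neg_apply, abs_neg]; exact hMy k
  rw [sub_eq_add_neg, sub_eq_add_neg, cLim_add hMx hneg]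
  congr 1
  have h1 := cLim_smul hMy (-1)
  rw [neg_one_smul, neg_one_mul] at h1
  exact h1.symm

end SeqLim

/-! ## Invariance under the unit vectors gives invariance under all translations -/

section Generators

variable {d : ℕ} {G : Type*} [TopologicalSpace G]

/-- Translating by `0` is the identity. -/
theorem comp_relabelCM_edgeShift_zero (x : C(LGConfig d G, ℝ)) :
    x.comp (relabelCM (G := G) (edgeShift (0 : Fin d → ℤ))) = x := by
  ext U
  simp only [ContinuousMap.comp_apply]
  congr 1
  funext e
  simp only [relabelCM_apply, edgeShift_apply, add_zero]

/-- **Invariance of a functional on a translation-stable set under all unit translations implies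
invariance under every translation** (the unit vectors generate `ℤ^d`). -/
theorem forall_invariant_of_single (Λ : C(LGConfig d G, ℝ) →ₗ[ℝ] ℝ) {V : Set C(LGConfig d G, ℝ)}
    (hV : ∀ (v : Fin d → ℤ), ∀ x ∈ V, x.comp (relabelCM (G := G) (edgeShift v)) ∈ V)
    (h : ∀ j : Fin d, ∀ x ∈ V, Λ (x.comp (relabelCM (G := G) (edgeShift (Pi.single j 1)))) = Λ x)
    (a : Fin d → ℤ) : ∀ x ∈ V, Λ (x.comp (relabelCM (G := G) (edgeShift a))) = Λ x := by
  -- the set of good translations is a `ℤ`-submodule containing the unit vectors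
  let W : Submodule ℤ (Fin d → ℤ) :=
    { carrier := {a | ∀ x ∈ V, Λ (x.comp (relabelCM (G := G) (edgeShift a))) = Λ x}
      zero_mem' := fun x _ => by rw [comp_relabelCM_edgeShift_zero]
      add_mem' := fun {a b} ha hb x hx => by
        rw [← comp_relabelCM_edgeShift_comp, hb _ (hV a x hx), ha x hx]
      smul_mem' := fun c a ha => by
        induction c using Int.induction_on with
        | zero => intro x _; rw [zero_smul, comp_relabelCM_edgeShift_zero]
        | succ m ih =>
          intro x hx
          rw [add_smul, one_smul, ← comp_relabelCM_edgeShift_comp, ha _ (hV _ x hx), ih x hx]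
        | pred m ih =>
          intro x hx
          -- `x ∘ τ_{(−m−1)a} = ((x ∘ τ_{(−m−1)a}) ∘ τ_a) ∘ τ_{−a}`-style: use `ih` on the translate
          have h1 := ih (x.comp (relabelCM (G := G) (edgeShift ((-(m : ℤ) - 1) • a))))
            (hV _ x hx)
          rw [comp_relabelCM_edgeShift_comp] at h1
          have h2 := ha (x.comp (relabelCM (G := G) (edgeShift ((-(m : ℤ) - 1) • a)))) (hV _ x hx)
          rw [comp_relabelCM_edgeShift_comp] at h2
          have he : (-(m : ℤ) - 1) • a + a = -(m : ℤ) • a := by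
            rw [sub_smul, one_smul, sub_add_cancel]
          rw [he] at h2
          rw [← h2]
          -- now `Λ (x ∘ τ_{-m a}) = Λ x` from `h1`: `(-m-1)a + (-m)a`? use `ih` directly instead
          exact ih x hx }
  have hW : ∀ j : Fin d, Pi.single j (1 : ℤ) ∈ W := fun j x hx => h j x hx
  have htop : (⊤ : Submodule ℤ (Fin d → ℤ)) ≤ W := by
    rw [← (Pi.basisFun ℤ (Fin d)).span_eq, Submodule.span_le]
    rintro _ ⟨j, rfl⟩
    rw [Pi.basisFun_apply]
    exact hW j
  exact htop (Submodule.mem_top : a ∈ ⊤)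

end Generators

end Summit.QuantumFields.GaugeBoot

end
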